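import Literature.AlgebraicGeometry.Motives.AbelianVarietyBaseChange
import HarnessLib

/-!
# Transitivity of base change for abelian varieties: `(A ⊗_k k′) ⊗_{k′} S ≅ A ⊗_k S`

Topic `Literature/AlgebraicGeometry/Motives` (family `hodge`, lane `lit-hodgefound`; junction for the B34 lineage
`IsCMTypeRealisationOver` of `NumberTheory/ComplexMultiplication`).  Definitions with bodies and theorems; no named
fact (net Literature debt 0).

Görtz–Wedhorn, *Algebraic Geometry I* [GortzWedhorn2020], Prop. 4.16: «for all morphisms `S″ → S′` we have a
canonical isomorphism `X_{(S′)} ×_{S′} S″ ≅ X_{(S″)}`» (transitivity of fibre products, §(4.7)–(4.8)), which is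
functorial in `X`; for a tower of fields `k → k′ → S` (`IsScalarTower k k′ S`, so that
`Spec S → Spec k′ → Spec k` is `Spec S → Spec k`) this is an isomorphism of functors
`(− ⊗_k k′) ⊗_{k′} S ≅ − ⊗_k S : Sch/k ⥤ Sch/S` (Mathlib's `Over.pullbackComp`), and since base change of
abelian varieties IS Mathlib's `Functor.mapGrp` of the cartesian-monoidal functor `Over.pullback`
(`AbelianVariety.baseChange_toGrp`, `Hom.baseChange`), it lifts to group objects (`Functor.mapGrpCompIso`,
`Functor.mapGrpNatIso`) — Mumford, *Abelian Varieties* §19 p. 176 / Görtz–Wedhorn Remark 16.54 (base change of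
homomorphisms).  The tree had the object-level scheme isomorphism (`FiberBaseChange.baseChangeHomObjIsoOfComp`,
used ad hoc in `Liu2021/AlbaneseBaseChangeJointlyEpi`) but not the isomorphism of ABELIAN VARIETIES natural in
homomorphisms, which is what transports structures `ι₀ : 𝓞_K → End_k(A₀)` along `k ⊆ k′`.

* §1 `bcSpec_comp_bcSpec_of_isScalarTower` (`Spec S → Spec k′ → Spec k = Spec S → Spec k`), `overPullbackCongr`
  (`Over.pullback` along equal morphisms),
  **`bcFunctorTowerIso k k′ S : bcFunctor k k′ ⋙ bcFunctor k′ S ≅ bcFunctor k S`**;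
* §2 **`baseChangeTowerGrpNatIso`** (on group objects), **`AbelianVariety.baseChangeTowerIso A :
  (A.baseChange k′).baseChange S ≅ A.baseChange S`**, and its NATURALITY
  **`Hom.baseChange_baseChange_comp_baseChangeTowerIso_hom`** (`(f_{k′})_S ≫ e_B = e_A ≫ f_S`),
  `baseChangeTowerIso_inv_comp_baseChange_baseChange`, `baseChangeTowerIso_conj` (for endomorphisms:
  `e_A⁻¹ ≫ (f_{k′})_S ≫ e_A = f_S`);
* §3 **`AbelianVariety.baseChangeFunctorTowerIso : baseChangeFunctor k k′ ⋙ baseChangeFunctor k′ S ≅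
  baseChangeFunctor k S`**.

## References

* [GortzWedhorn2020] U. Görtz, T. Wedhorn, *Algebraic Geometry I* (2nd ed. 2020), Prop. 4.16, §(4.7)–(4.8),
  Remark 16.54.
* [MumfordAV1970] D. Mumford, *Abelian Varieties* (1970), §19 (p. 176).
-/

noncomputable section

open CategoryTheory CategoryTheory.Limits AlgebraicGeometry

universe u

namespace Literature.AlgebraicGeometry.Motives

/-! ## §1 The tower isomorphism of base-change functors on `k`-schemes -/

/-- `Over.pullback` along equal morphisms of schemes gives isomorphic (indeed equal) functors.
[cite: GortzWedhorn2020, §(4.7)] -/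
def overPullbackCongr {X Y : Scheme.{u}} {f g : X ⟶ Y} (h : f = g) : Over.pullback f ≅ Over.pullback g :=
  eqToIso (by subst h; rfl)

namespace AbelianVariety

variable (k k' S : Type u) [Field k] [Field k'] [Field S] [Algebra k k'] [Algebra k' S] [Algebra k S]
  [IsScalarTower k k' S]

/-- In a tower `k → k′ → S`, `(k′ → S) ∘ (k → k′) = (k → S)` (Mathlib `IsScalarTower.algebraMap_eq`). [folklore] -/
private theorem algebraMap_comp_algebraMap_of_isScalarTower :
    (algebraMap k' S).comp (algebraMap k k') = algebraMap k S :=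
  (IsScalarTower.algebraMap_eq k k' S).symm

/-- In a tower `k → k′ → S`: `Spec S → Spec k′ → Spec k` is `Spec S → Spec k`. [cite: GortzWedhorn2020, §(4.7)] -/
theorem bcSpec_comp_bcSpec_of_isScalarTower : bcSpec k' S ≫ bcSpec k k' = bcSpec k S := by
  change Spec.map _ ≫ Spec.map _ = Spec.map (CommRingCat.ofHom (algebraMap k S))
  rw [← algebraMap_comp_algebraMap_of_isScalarTower k k' S, ← Spec.map_comp]
  rfl

/-- **Transitivity of base change on `k`-schemes** (Görtz–Wedhorn I, Prop. 4.16), functorially: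
`(− ⊗_k k′) ⊗_{k′} S ≅ − ⊗_k S` as functors `Sch/k ⥤ Sch/S` — Mathlib's `Over.pullbackComp` for
`Spec S → Spec k′ → Spec k`, followed by `Spec S → Spec k′ → Spec k = Spec S → Spec k`.
[cite: GortzWedhorn2020, Prop. 4.16 and §(4.7)] -/
def bcFunctorTowerIso : bcFunctor k k' ⋙ bcFunctor k' S ≅ bcFunctor k S :=
  (Over.pullbackComp (bcSpec k' S) (bcSpec k k')).symm ≪≫
    overPullbackCongr (bcSpec_comp_bcSpec_of_isScalarTower k k' S)

/-! ## §2 The tower isomorphism of abelian varieties, natural in homomorphisms -/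

/-- The tower isomorphism on GROUP objects: `mapGrp` of `bcFunctorTowerIso` composed with
`mapGrp (F ⋙ G) ≅ mapGrp F ⋙ mapGrp G` (base change of group schemes is `Functor.mapGrp` of the cartesian-monoidal
`Over.pullback`). [cite: GortzWedhorn2020, Prop. 4.16 and Remark 16.54] -/
def baseChangeTowerGrpNatIso :
    (bcFunctor k k').mapGrp ⋙ (bcFunctor k' S).mapGrp ≅ (bcFunctor k S).mapGrp :=
  (Functor.mapGrpCompIso (F := bcFunctor k k') (G := bcFunctor k' S)).symm ≪≫
    Functor.mapGrpNatIso (bcFunctorTowerIso k k' S)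

/-- **`(A ⊗_k k′) ⊗_{k′} S ≅ A ⊗_k S` as abelian varieties over `S`** (transitivity of base change,
Görtz–Wedhorn I Prop. 4.16, for the group objects underlying abelian varieties).
[cite: GortzWedhorn2020, Prop. 4.16 and Remark 16.54] [cite: MumfordAV1970, §19 (p. 176)] -/
def baseChangeTowerIso (A : AbelianVariety k) : (A.baseChange k').baseChange S ≅ A.baseChange S :=
  InducedCategory.isoMk ((baseChangeTowerGrpNatIso k k' S).app A.toGrp)

variable {k}

/-- **Naturality of the tower isomorphism in homomorphisms**: for `f : A ⟶ B` over `k`,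
`(f_{k′})_S ≫ e_B = e_A ≫ f_S` (base change of homomorphisms is functorial and compatible with the transitivity
isomorphism; Mumford §19: `Hom_k(A, B) ⊆ Hom_{k′}(A_{k′}, B_{k′})`).
[cite: GortzWedhorn2020, Prop. 4.16 and Remark 16.54] [cite: MumfordAV1970, §19 (p. 176)] -/
@[reassoc]
theorem Hom.baseChange_baseChange_comp_baseChangeTowerIso_hom {A B : AbelianVariety k} (f : A ⟶ B) :
    Hom.baseChange S (Hom.baseChange k' f) ≫ (baseChangeTowerIso k k' S B).hom =
      (baseChangeTowerIso k k' S A).hom ≫ Hom.baseChange S f :=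
  InducedCategory.hom_ext ((baseChangeTowerGrpNatIso k k' S).hom.naturality f.hom)

/-- … the same for the inverse isomorphisms: `e_A⁻¹ ≫ (f_{k′})_S = f_S ≫ e_B⁻¹`.
[cite: GortzWedhorn2020, Prop. 4.16 and Remark 16.54] -/
@[reassoc]
theorem baseChangeTowerIso_inv_comp_baseChange_baseChange {A B : AbelianVariety k} (f : A ⟶ B) :
    (baseChangeTowerIso k k' S A).inv ≫ Hom.baseChange S (Hom.baseChange k' f) =
      Hom.baseChange S f ≫ (baseChangeTowerIso k k' S B).inv := by
  rw [Iso.inv_comp_eq, ← Category.assoc, Iso.eq_comp_inv,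
    Hom.baseChange_baseChange_comp_baseChangeTowerIso_hom]

/-- **Conjugation form for endomorphisms**: `e_A⁻¹ ≫ (f_{k′})_S ≫ e_A = f_S` for `f ∈ End_k(A)` — the two-step
base change of an endomorphism IS its one-step base change, read through the tower isomorphism.
[cite: GortzWedhorn2020, Prop. 4.16 and Remark 16.54] [cite: MumfordAV1970, §19 (p. 176)] -/
theorem baseChangeTowerIso_conj {A : AbelianVariety k} (f : A ⟶ A) :
    (baseChangeTowerIso k k' S A).inv ≫ Hom.baseChange S (Hom.baseChange k' f) ≫
      (baseChangeTowerIso k k' S A).hom = Hom.baseChange S f := by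
  rw [Hom.baseChange_baseChange_comp_baseChangeTowerIso_hom, Iso.inv_hom_id_assoc]

/-! ## §3 As an isomorphism of base-change functors on abelian varieties -/

variable (k) in
/-- **`(− ⊗_k k′) ⊗_{k′} S ≅ − ⊗_k S` on abelian varieties** (`baseChangeFunctor`), assembled from
`baseChangeTowerIso` and its naturality. [cite: GortzWedhorn2020, Prop. 4.16 and Remark 16.54] -/
def baseChangeFunctorTowerIso :
    baseChangeFunctor k k' ⋙ baseChangeFunctor k' S ≅ baseChangeFunctor k S :=
  NatIso.ofComponents (fun A => baseChangeTowerIso k k' S A)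
    (fun f => Hom.baseChange_baseChange_comp_baseChangeTowerIso_hom k' S f)

end AbelianVariety

end Literature.AlgebraicGeometry.Motives

end
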